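import Mathlib
import HarnessLib
import Summits.ValiantsHypothesis.ValiantsHypothesis.Theorems.MonotoneRestorationOrbitRestorationQPColUntwistedMain

/-!
# Label-stabiliser scalars of a column grouping are signs

Route MonotoneRestoration, crux `OrbitRestorationQP` (stmt-ValiantsHypothesis-18293), SPAN-currency lane of the open
sub-rung A_∞ (`stub_sigmaPiSigmaValue`), `ΠΣ` part.  Helper (`--supports`), def-free.  Sharpens the hypothesis of
`SuperAtoms.prod_mem_narrowSpan_of_colStabUntwisted_supports`: for an occurring column label `T` and a column renaming
`τ` with `τ • T = T`, the scalar `c` in `τ · G_T = c · G_T` (`G_T = Π_{S(L_i) = T} L_i`) satisfies `c² = 1`.  So the only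
obstruction handled by that hypothesis is a genuine SIGN character of `Sym(T)` on the grouping (the "column-twisted"
groupings of the residue analysis in `SIGN-LANE-g7g6.md`), never a higher root of unity.

* `smul_finset_eq_of_swap_mem`, `ofSubtype_smul_finset_eq` — permutations supported in `T` stabilise `T`;
* **`groupingScalar_mul_self_eq_one`** — the statement above (decompose `τ = π ρ` with `π` supported in `T` and `ρ`
  fixing `T` pointwise; `ρ` fixes the grouping, `π` is a product of transpositions of `T`, each acting by a scalar of
  square `1`; `Equiv.Perm.swap_induction_on` on `Perm ↥T`).

No registered stub is closed; the crux and VP ≠ VNP are not moved. [folklore]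
-/

noncomputable section

open scoped Pointwise

-- `Summit.ValiantsHypothesis.ValiantsHypothesis.…` is the tree's single-conjunct layout (Sub = Summit).
set_option linter.dupNamespace false

namespace Summit.ValiantsHypothesis.ValiantsHypothesis.Theorems

namespace SuperAtoms

open MvPolynomial Finset Equiv ProductAction

variable {n : ℕ}

/-- A transposition of two elements of `T` stabilises `T`. [folklore] -/
theorem smul_finset_eq_of_swap_mem (T : Finset (Fin n)) {x y : Fin n} (hx : x ∈ T) (hy : y ∈ T) :
    swap x y • T = T := by
  classical
  have hmem : ∀ z ∈ T, swap x y z ∈ T := by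
    intro z hz
    rcases eq_or_ne z x with rfl | hzx
    · rwa [swap_apply_left]
    rcases eq_or_ne z y with rfl | hzy
    · rwa [swap_apply_right]
    rwa [swap_apply_of_ne_of_ne hzx hzy]
  ext z
  rw [Finset.mem_smul_finset]
  constructor
  · rintro ⟨w, hw, rfl⟩
    exact hmem w hw
  · intro hz
    exact ⟨swap x y z, hmem z hz, by rw [Perm.smul_def, swap_apply_self]⟩

/-- A permutation of `↥T` extended by the identity stabilises `T`. [folklore] -/
theorem ofSubtype_smul_finset_eq (T : Finset (Fin n)) (f : Perm {x // x ∈ T}) :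
    Perm.ofSubtype f • T = T := by
  classical
  ext z
  rw [Finset.mem_smul_finset]
  constructor
  · rintro ⟨w, hw, rfl⟩
    rw [Perm.smul_def, Perm.ofSubtype_apply_of_mem f hw]
    exact (f ⟨w, hw⟩).2
  · intro hz
    refine ⟨((f⁻¹ ⟨z, hz⟩ : {x // x ∈ T}) : Fin n), (f⁻¹ ⟨z, hz⟩).2, ?_⟩
    rw [Perm.smul_def, Perm.ofSubtype_apply_coe, Perm.inv_def, Equiv.apply_symm_apply]

/-- **LABEL-STABILISER SCALARS OF A COLUMN GROUPING ARE SIGNS.**  In the setting of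
`prod_mem_narrowSpan_of_colStabUntwisted_supports`: if `T` occurs, `τ • T = T` and `τ · G_T = c · G_T`, then `c * c = 1`.
[folklore] -/
theorem groupingScalar_mul_self_eq_one {ι : Type} [Fintype ι] (L : ι → MvPolynomial (Fin n × Fin n) ℂ) (a : ℂ)
    (hL1 : ∀ i, (L i).totalDegree = 1) (hf0 : C a * ∏ i, L i ≠ 0)
    (hfix : ∀ σ τ : Perm (Fin n),
      rename (fun P : Fin n × Fin n => (σ P.1, τ P.2)) (C a * ∏ i, L i) = C a * ∏ i, L i)
    (S : MvPolynomial (Fin n × Fin n) ℂ → Finset (Fin n))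
    (S1 : ∀ (q : MvPolynomial (Fin n × Fin n) ℂ) (u : ℂ), u ≠ 0 → S (C u * q) = S q)
    (S2 : ∀ (q : MvPolynomial (Fin n × Fin n) ℂ) (τ : Perm (Fin n)), S (vact (K := ℂ) colHom τ q) = τ • S q)
    (S3 : ∀ (q : MvPolynomial (Fin n × Fin n) ℂ) (σ : Perm (Fin n)), S (vact (K := ℂ) rowHom σ q) = S q)
    (hSfix : ∀ (i : ι) (ρ : Perm (Fin n)), (∀ x ∈ S (L i), ρ x = x) → vact (K := ℂ) colHom ρ (L i) = L i)
    (T : Finset (Fin n)) (τ : Perm (Fin n)) (hτ : τ • T = T) (c : ℂ)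
    (h : rename (fun P : Fin n × Fin n => (P.1, τ P.2)) (∏ i ∈ (univ : Finset ι).filter (fun i => S (L i) = T), L i) =
      C c * ∏ i ∈ (univ : Finset ι).filter (fun i => S (L i) = T), L i) :
    c * c = 1 := by
  classical
  have hL0 : ∀ i, L i ≠ 0 := by
    intro i h
    exact hf0 (by rw [Finset.prod_eq_zero (Finset.mem_univ i) h, mul_zero])
  set G : MvPolynomial (Fin n × Fin n) ℂ := ∏ i ∈ (univ : Finset ι).filter (fun i => S (L i) = T), L i with hG
  have hG0 : G ≠ 0 := Finset.prod_ne_zero_iff.2 fun i _ => hL0 i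
  -- scalars of stabilising renamings exist (block transport)
  have hex : ∀ ρ : Perm (Fin n), ρ • T = T → ∃ d : ℂ,
      rename (fun P : Fin n × Fin n => (P.1, ρ P.2)) G = C d * G := by
    intro ρ hρ
    obtain ⟨d, -, hd⟩ := NormalisedFactors.exists_unit_labelBlock_rowCol L a hL1 hf0 1 ρ (hfix 1 ρ) S
      (fun T : Finset (Fin n) => ρ • T) (fun T T' h => smul_left_cancel ρ h) S1 (fun i => by
        rw [rename_prod_eq, S3, S2]) T
    refine ⟨d, ?_⟩
    rw [hρ] at hd
    exact hd
  -- renamings fixing `T` pointwise fix the grouping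
  have hfixpt : ∀ ρ : Perm (Fin n), (∀ x ∈ T, ρ x = x) → rename (fun P : Fin n × Fin n => (P.1, ρ P.2)) G = G := by
    intro ρ hρ
    rw [hG, map_prod]
    refine Finset.prod_congr rfl fun i hi => ?_
    have hiT : S (L i) = T := (Finset.mem_filter.1 hi).2
    rw [← vact_colHom_eq_rename]
    exact hSfix i ρ fun x hx => hρ x (by rwa [hiT] at hx)
  -- transpositions of `T` act by scalars of square one
  have hswap : ∀ x y : {z // z ∈ T}, x ≠ y → ∀ d : ℂ,
      rename (fun P : Fin n × Fin n => (P.1, swap (x : Fin n) y P.2)) G = C d * G → d * d = 1 := by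
    intro x y _ d hd
    apply scalar_eq_of_mul_eq hG0
    have h2 := congrArg (rename (fun P : Fin n × Fin n => (P.1, swap (x : Fin n) y P.2))) hd
    rw [rename_col_mul, swap_mul_self, rename_col_one, map_mul, rename_C, hd, ← mul_assoc, ← map_mul] at h2
    rw [map_one, one_mul]
    exact h2.symm
  -- permutations supported in `T` act by scalars of square one
  have hclaim : ∀ (f : Perm {z // z ∈ T}) (d : ℂ),
      rename (fun P : Fin n × Fin n => (P.1, Perm.ofSubtype f P.2)) G = C d * G → d * d = 1 := by
    intro f
    induction f using Equiv.Perm.swap_induction_on with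
    | one =>
      intro d hd
      rw [map_one, rename_col_one] at hd
      have : d = 1 := (scalar_eq_of_mul_eq hG0 (by rw [C_1, one_mul]; exact hd)).symm
      rw [this, one_mul]
    | swap_mul f x y hxy ih =>
      intro d hd
      obtain ⟨d', hd'⟩ := hex (Perm.ofSubtype f) (ofSubtype_smul_finset_eq T f)
      obtain ⟨s, hs⟩ := hex (swap (x : Fin n) y) (smul_finset_eq_of_swap_mem T x.2 y.2)
      rw [map_mul, Perm.ofSubtype_swap_eq, ← rename_col_mul, hd', map_mul, rename_C, hs, ← mul_assoc, ← map_mul] at hd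
      have hdd : d = d' * s := (scalar_eq_of_mul_eq hG0 hd).symm
      rw [hdd]
      calc d' * s * (d' * s) = (d' * d') * (s * s) := by ring
        _ = 1 := by rw [ih d' hd', hswap x y hxy s hs, one_mul]
  -- decompose `τ = π ρ` with `π` supported in `T` and `ρ` fixing `T` pointwise
  have hτ' : ∀ x : Fin n, x ∈ T ↔ τ x ∈ T := by
    intro x
    constructor
    · intro hx
      rw [← hτ]
      exact Finset.smul_mem_smul_finset hx
    · intro hx
      rw [← hτ, Finset.mem_smul_finset] at hx
      obtain ⟨w, hw, hwx⟩ := hx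
      rw [Perm.smul_def] at hwx
      rwa [← τ.injective hwx]
  set π : Perm (Fin n) := Perm.ofSubtype (τ.subtypePerm fun x => (hτ' x).symm) with hπ
  have hπT : ∀ x ∈ T, π x = τ x := by
    intro x hx
    rw [hπ, Perm.ofSubtype_apply_of_mem _ hx, Perm.subtypePerm_apply]
  have hρ : ∀ x ∈ T, (π⁻¹ * τ) x = x := by
    intro x hx
    rw [Perm.mul_apply, ← hπT x hx, Perm.inv_def, Equiv.symm_apply_apply]
  have hdecomp : rename (fun P : Fin n × Fin n => (P.1, τ P.2)) G = rename (fun P : Fin n × Fin n => (P.1, π P.2)) G := by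
    conv_lhs => rw [show τ = π * (π⁻¹ * τ) by rw [mul_inv_cancel_left]]
    rw [← rename_col_mul, hfixpt _ hρ]
  rw [hdecomp] at h
  exact hclaim _ c h

end SuperAtoms

end Summit.ValiantsHypothesis.ValiantsHypothesis.Theorems

end
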